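import Literature.NumberTheory.Automorphic.FontaineMazurGL2OddPrime
import Literature.NumberTheory.GaloisRepresentations.OrdinaryTwistedDeterminant
import HarnessLib

/-!
# Fontaine–Mazur for `GL₂/ℚ` at an odd prime, regular case: the rendering with a TATE twist
# (Pan 2022, Thms. 1.0.4, 7.1.1, 8.0.24; X. Zhang 2024, Thms. 1.0.2, 5.1.1, 6.1.1)

Topic `Literature/NumberTheory/Automorphic`; companion of `FontaineMazurGL2OddPrime`, whose named
fact `XZhang2024_fontaineMazurGL2_oddPrime` vendors the same printed theorem in the WEAKEST
reading of the words "up to twist" (some continuous `χ : Γ_ℚ → ℚ̄_pˣ` with `ρ ⊗ χ` attached to a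
newform).  This file vendors the reading the sources actually print in their main theorems — the
twist is a TATE twist, an integral power `ε_p^m` of the `p`-adic cyclotomic character — as the
named fact `XZhang2024_fontaineMazurGL2_tateTwist` (D-0014), and proves that it implies the weak
reading (`XZhang2024_fontaineMazurGL2_tateTwist.oddPrime`).

## The printed theorems (held texts, quoted)

* L. Pan, J. Amer. Math. Soc. 35 (2022) = arXiv:1901.07166 [Pan2022].  Conj. 1.0.1 (Fontaine–Mazur):
  "`ρ : Gal(ℚ̄/ℚ) → GL₂(ℚ̄_p)` continuous, irreducible … only ramified at finitely many places, …
  potentially semi-stable …, odd … Then `ρ` arises from a cuspidal eigenform."  **Thm. 1.0.4**: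
  "Let `p` be an odd prime and `ρ` be as in conjecture 1.0.1. Assume that • `ρ|_{Gal(ℚ̄_p/ℚ_p)}`
  has distinct Hodge–Tate weights, • If `p = 3`, [a local proviso]. Then `ρ` comes from a cuspidal
  eigenform."  The theorems this assembles state the conclusion AUTOMORPHICALLY: **Thm. 7.1.1**
  (residually reducible, `F` totally real abelian with `p` split — e.g. `F = ℚ`): "Then `ρ` arises
  from a twist of a Hilbert modular form, i.e. a regular algebraic cuspidal automorphic
  representation of `GL₂(𝔸_F)`"; **Thm. 8.0.24** (residually irreducible; for `F = ℚ` the residual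
  automorphy hypothesis holds by Khare–Wintenberger, Remark 8.0.26): "Then `ρ` arises from a
  regular algebraic cuspidal automorphic representation of `GL₂(𝔸_F)`."
* X. Zhang, arXiv:2412.06812 (2024) [XZhang2024FontaineMazurP3].  **Thm. 1.0.2** "(Theorem 5.1.1,
  Theorem 6.1.1)": "Let `p` be an odd prime number and `ρ : Gal(ℚ̄/ℚ) → GL₂(ℚ̄_p)` be a
  continuous, irreducible representation such that • `ρ` is only ramified at finitely many places,
  • `ρ|_{G_{ℚ_p}}` is de Rham of distinct Hodge–Tate weights, • `ρ` is odd, Then `ρ` arises from a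
  cuspidal eigenform up to twist."  **Thm. 5.1.1** (p. 26): "Then `ρ` arises from a twist of a
  Hilbert modular form, i.e. a regular algebraic cuspidal automorphic representation of
  `GL₂(𝔸_F)`"; **Thm. 6.1.1** (p. 33): "Then `ρ` arises from a regular algebraic cuspidal
  automorphic representation of `GL₂(𝔸_F)`"; Remark 6.1.2: "In the ordinary case, the result is
  known by [Skinner–Wiles 2001], [Kisin 2009] and [Hu–Tan 2015]."

So the printed conclusion, in the papers' own gloss of "up to twist" ("a twist of a Hilbert modular
form, **i.e.** a regular algebraic cuspidal automorphic representation"), is: `ρ ≅ r_ι(π)` for a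
regular algebraic cuspidal `π` on `GL₂(𝔸_ℚ)`.  Over `ℚ` such a `π` is `π_f ⊗ |det|^s` for a
newform `f` of weight `k ≥ 2` and a half-integer `s` making `π` algebraic, and
`r_ι(π_f ⊗ |det|^s) = ρ_{f,ι_f} ⊗ ε_p^m` with `m ∈ ℤ` (`ι_f = ι⁻¹|_{K_f}`; Deligne's `ρ_{f,ι_f}`,
unramified at `q ∤ N p` with `charpoly(Frob_q) = ι_f(X² - a_q X + ε_f(q) q^{k-1})`, Deligne–Serre
1974 Thm. 6.1; `r_ι(|·|^{-1}) = ε_p`).  Equivalently: **some Tate twist `ρ ⊗ ε_p^{m}` (`m ∈ ℤ`) is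
the Galois representation of a newform** — the normalisation every printed proof uses to move the
Hodge–Tate weights `{a, b}` of `ρ` to `{0, k-1}` (Kisin 2009, Introduction; Emerton's "`ρ` is a
twist of the Galois representation attached to a cuspidal newform").  This is the statement
vendored below, in the classical vocabulary of `FontaineMazurGL2OddPrime` (`IsNewform1`,
`coeffCharField`, `IsGaloisRepOfNewform1 f ι_f {q ∣ N p}`), with the twisting character written
`χ`, `χ(σ) = ε_p(σ)^m` (`cyclotomicPadicAlgCl ℚ p`, the accepted `ℚ̄_p`-valued cyclotomic character).

## Why a second rendering

The weak reading loses exactly the information a consumer of the automorphic form needs: to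
absorb an ARBITRARY continuous `χ` into `π` one must first show `χ = ε_p^m · θ` with `θ` of finite
order, which takes `p`-adic Hodge theory the tree does not have (de Rham representations are
stable under twists and duals; `ρ_f` is de Rham at `p` — Faltings, Tsuji, T. Saito 1997; de Rham
characters of `G_{ℚ_p}` are `ε_p^m` up to a finitely ramified character — Tate 1967, Sen 1973),
whereas the printed theorems assert the automorphic conclusion outright.  The weak fact follows
from this one by forgetting that `χ` is a Tate twist (`XZhang2024_fontaineMazurGL2_tateTwist.oddPrime`).
Consumer: route `Langlands/DyadicOddResidue`, item `OddPrimesRegularFM` (the summit's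
`L`-algebraic automorphic rendering), derived from this fact in
`Summits/Langlands/Langlands/Theorems/DyadicOddResidueOddPrimesRegularFM*`.

## What is NOT here

No discharge (irreducibly XL: `p`-adic local Langlands for `GL₂(ℚ_p)`, patching of completed
homology, Skinner–Wiles); `p = 2`; `F ≠ ℚ`; the local–global compatibility at the ramified places
and at `p` of the printed automorphic statement (only the a.e. unramified dictionary is rendered,
as in `FontaineMazurGL2OddPrime`).

## References

* L. Pan, J. Amer. Math. Soc. 35 (2022) 1031–1169, Conj. 1.0.1, Thm. 1.0.4, Thm. 7.1.1,
  Thm. 8.0.24, Remark 8.0.26 (numbering of arXiv:1901.07166). [Pan2022]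
* X. Zhang, *On the Fontaine–Mazur conjecture for `p = 3`*, arXiv:2412.06812 (2024), Thm. 1.0.2,
  Thm. 5.1.1, Thm. 6.1.1, Remark 6.1.2. [XZhang2024FontaineMazurP3]
* M. Kisin, J. Amer. Math. Soc. 22 (2009), Theorem of the Introduction. [Kisin2009]
* C. Skinner, A. Wiles, Publ. Math. IHÉS 89 (1999). [SkinnerWiles1999]
* Y. Hu, F. Tan, Ann. Sci. ÉNS 48 (2015), Thm. 1.4. [HuTan2015]
* S.-N. Tung, Algebra Number Theory 15 (2021), Thm. 1. [Tung2021]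
* P. Deligne, J.-P. Serre, Ann. Sci. ÉNS 7 (1974), Thm. 6.1 (normalisation of `ρ_{f,λ}`).
  [DeligneSerreASENS1974]
* K. Buzzard, T. Gee, LMS Lecture Note Ser. 414 (2014), §3.1, Conj. 3.2.2. [BuzzardGeeLMS2014]
-/

noncomputable section

open scoped MatrixGroups Matrix NumberField ModularForm
open NumberField IsDedekindDomain Field Filter CongruenceSubgroup

namespace Literature.NumberTheory.Automorphic

open Literature.NumberTheory.GaloisRepresentations
open Literature.NumberTheory.EllipticCurves.ModularForms

/-- **Pan 2022, Thm. 1.0.4 with Thms. 7.1.1/8.0.24; X. Zhang 2024, Thm. 1.0.2 (= Thms. 5.1.1, 6.1.1)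
(with Skinner–Wiles, Kisin 2009, Hu–Tan 2015, Tung 2021, Khare–Wintenberger): Fontaine–Mazur
modularity for `GL₂` over `ℚ` in the regular case at EVERY odd prime — rendering with a TATE
twist** (module docstring for the printed statements and the rendering).  Let `p > 2` and let
`ρ : Γ_ℚ → GL₂(ℚ̄_p)` be continuous, unramified at all but finitely many places, irreducible and
odd, such that `ρ|_{Γ_{ℚ_p}}` is de Rham (Fontaine's pinned datum `fontainePstAdicCompletion`) with
distinct labelled Hodge–Tate weights.  Then `ρ` "arises from a regular algebraic cuspidal
automorphic representation of `GL₂(𝔸_ℚ)`", i.e. some Tate twist of `ρ` is the Galois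
representation of a newform: there are a continuous character `χ : Γ_ℚ → ℚ̄_pˣ` with
`χ(σ) = ε_p(σ)^m` for an integer `m` (`ε_p = cyclotomicPadicAlgCl ℚ p`), a newform
`f ∈ S_k(Γ₁(N))` and an embedding `ι_f : K_f → ℚ̄_p` of its coefficient field such that `ρ ⊗ χ` is
attached to `f` away from `N p` — unramified at every prime `q ∤ N p` with
`charpoly (ρ ⊗ χ)(Frob_q) = ι_f(X² - a_q(f) X + ε_f(q) q^{k-1})` (arithmetic Frobenius).  VERBATIM
`XZhang2024_fontaineMazurGL2_oddPrime` with the clause `∀ σ, χ σ = ε_p(σ)^m` added.  Named fact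
(D-0014); users take `(h : XZhang2024_fontaineMazurGL2_tateTwist)`.
[cite: XZhang2024FontaineMazurP3, Thm. 1.0.2 (= Thms. 5.1.1 and 6.1.1, pp. 26 and 33 of arXiv:2412.06812: "arises from a regular algebraic cuspidal automorphic representation of GL₂(𝔸_F)")]
[cite: Pan2022, Thm. 1.0.4 with Thm. 7.1.1 and Thm. 8.0.24 (arXiv:1901.07166)]
[cite: Kisin2009, Theorem of the Introduction (p. 642)] [cite: DeligneSerreASENS1974, Thm. 6.1] -/
def XZhang2024_fontaineMazurGL2_tateTwist : Prop :=
  ∀ (p : ℕ) [Fact p.Prime], p ≠ 2 →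
    ∀ (ρ : FramedGaloisRep ℚ (PadicAlgCl p) 2),
      (∀ᶠ v : HeightOneSpectrum (𝓞 ℚ) in cofinite, ρ.IsUnramifiedAt v) →
      ρ.toGaloisRep.IsIrreducible → ρ.IsOdd →
      (∀ (v : HeightOneSpectrum (𝓞 ℚ)) (hv : ((p : ℕ) : 𝓞 ℚ) ∈ v.asIdeal),
        (PAdicHodge.fontainePstAdicCompletion v p hv).IsDeRhamFramed (ρ.toLocal v) ∧
        ∀ τ : v.adicCompletion ℚ →+* PadicAlgCl p, Continuous τ →
          (ρ.labelledHodgeTateWeightsAt v (PAdicHodge.fontainePstAdicCompletion v p hv).algebra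
            (PAdicHodge.fontainePstAdicCompletion v p hv).𝔅 τ).Nodup) →
      ∃ (χ : absoluteGaloisGroup ℚ →ₜ* (PadicAlgCl p)ˣ) (m : ℤ),
        (∀ σ, χ σ = cyclotomicPadicAlgCl ℚ p σ ^ m) ∧
        ∃ (N : ℕ) (_ : NeZero N) (k : ℤ) (f : CuspForm (Gamma1 N) k)
          (ιf : coeffCharField f →+* PadicAlgCl p),
          IsNewform1 f ∧ IsGaloisRepOfNewform1 f ιf {q | q ∣ N * p} (FramedRep.twist ρ χ)

/-- The Tate-twist rendering implies the weak rendering `XZhang2024_fontaineMazurGL2_oddPrime`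
(forget that `χ` is a power of the cyclotomic character). [cite: XZhang2024FontaineMazurP3, Thm. 1.0.2] -/
theorem XZhang2024_fontaineMazurGL2_tateTwist.oddPrime (h : XZhang2024_fontaineMazurGL2_tateTwist) :
    XZhang2024_fontaineMazurGL2_oddPrime := by
  intro p _ hp ρ hunr hirr hodd hpst
  obtain ⟨χ, _, _, N, hN, k, f, ιf, hf, hρ⟩ := h p hp ρ hunr hirr hodd hpst
  exact ⟨χ, N, hN, k, f, ιf, hf, hρ⟩

/-- Hence also Tung's Theorem 1 (the case with the residual hypothesis), through
`XZhang2024_fontaineMazurGL2_oddPrime.tung2021`. [cite: Tung2021, Thm. 1] -/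
theorem XZhang2024_fontaineMazurGL2_tateTwist.tung2021 (h : XZhang2024_fontaineMazurGL2_tateTwist) :
    Tung2021_fontaineMazurGL2 :=
  h.oddPrime.tung2021

end Literature.NumberTheory.Automorphic

end
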